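import Literature.Computability.QuantumComplexity.CoreDescSLPCodes
import HarnessLib

/-!
# The layout compiler of straight-line programs in polynomial time

Topic `Literature/Computability/QuantumComplexity`; third step of the uniformity half of the
discharge of `ajl_jonesApproxProblem_mem_PromiseBQP` (AJL Thm. 1.2; Arora–Barak §6.2, proof of
Thm. 6.15: descriptions are printed with counters). The bit-level compiler `SLP.compile L prog`
(`RevSLP.lean`: registers, flags and scratch blocks laid out by `L : SLP.Layout`, one ripple-carry
adder / comparator / `AND` row per instruction) is a functional program over the instruction list:
`compileFrom` is a `flatten ∘ mapIdx` (`compileFrom_eq`), the adder and comparator templates are maps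
over the bit range (`map_addOps`, `map_ltOps`), and every wire is affine in the layout bases, the
instruction number and the bit index. We code reversible gates on `ℕ` wires (`clopE`) and prove, for
any family of layouts whose bases and input-wire map are computed on codes (`LayoutFP`), that
`(context, further inputs, program) ↦ SLP.compile (L context inputs) program` is computed in polynomial
time (`compile_codeFP`), in the typed `FP` algebra `CodeFP`.

## References

* D. Aharonov, V. Jones, Z. Landau, Algorithmica 55 (2009), Thm. 1.2 and §3.3 [AharonovJonesLandau2009].
* S. Arora, B. Barak, *Computational Complexity: A Modern Approach*, CUP 2009, §1.3 and §6.2 [AroraBarak2009].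
* V. Vedral, A. Barenco, A. Ekert, Phys. Rev. A 54 (1996) 147, §3 [VedralBarencoEkert1996].
-/

noncomputable section

namespace Literature.Computability.QuantumComplexity

open _root_.Computability Complexity Complexity.CodeFP SLP

namespace AJLCore

/-! ### Codes of reversible gates on `ℕ` wires -/

/-- The tuple of a reversible gate: tag and wires. [folklore] -/
def clopTuple : ClOp ℕ → ℕ × List ℕ
  | .not i => (0, [i])
  | .cnot i j => (1, [i, j])
  | .toffoli a b c => (2, [a, b, c])

/-- The code of a gate tuple. [folklore] -/
abbrev ctE : ℕ × List ℕ → List Bool := pairE natE (rawE natE)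

/-- The code of a reversible gate. [folklore] -/
def clopE : ClOp ℕ → List Bool := fun op => ctE (clopTuple op)

section ClopCodes

variable {α : Type} {eα : α → List Bool}

/-- A gate from its tuple computed on codes. [folklore] -/
theorem clop_of_tuple {g : α → ClOp ℕ} {t : α → ℕ × List ℕ} (ht : CodeFP eα ctE t) (h : ∀ a, clopTuple (g a) = t a) : CodeFP eα clopE g :=
  ht.recodeOut fun a => by rw [clopE]; exact congrArg ctE (h a).symm

/-- A list of two numerals. [folklore] -/
theorem natList2 {i j : α → ℕ} (hi : CodeFP eα natE i) (hj : CodeFP eα natE j) : CodeFP eα (rawE natE) (fun a => [i a, j a]) :=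
  ((rawCons natE).comp (hi.pair ((rawSingleton natE).comp hj)) :)

/-- A list of three numerals. [folklore] -/
theorem natList3 {i j l : α → ℕ} (hi : CodeFP eα natE i) (hj : CodeFP eα natE j) (hl : CodeFP eα natE l) :
    CodeFP eα (rawE natE) (fun a => [i a, j a, l a]) :=
  ((rawCons natE).comp (hi.pair (natList2 hj hl)) :)

/-- `NOT` on codes. [folklore] -/
theorem clop_not {i : α → ℕ} (hi : CodeFP eα natE i) : CodeFP eα clopE (fun a => ClOp.not (i a)) :=
  clop_of_tuple ((const eα 0).pair ((rawSingleton natE).comp hi)) fun _ => rfl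

/-- `CNOT` on codes. [folklore] -/
theorem clop_cnot {i j : α → ℕ} (hi : CodeFP eα natE i) (hj : CodeFP eα natE j) : CodeFP eα clopE (fun a => ClOp.cnot (i a) (j a)) :=
  clop_of_tuple ((const eα 1).pair (natList2 hi hj)) fun _ => rfl

/-- Toffoli on codes. [folklore] -/
theorem clop_toffoli {i j l : α → ℕ} (hi : CodeFP eα natE i) (hj : CodeFP eα natE j) (hl : CodeFP eα natE l) :
    CodeFP eα clopE (fun a => ClOp.toffoli (i a) (j a) (l a)) :=
  clop_of_tuple ((const eα 2).pair (natList3 hi hj hl)) fun _ => rfl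

/-- A one-gate program. [folklore] -/
theorem clopList1 {o : α → ClOp ℕ} (ho : CodeFP eα clopE o) : CodeFP eα (rawE clopE) (fun a => [o a]) := (rawSingleton clopE).comp ho

/-- Prepending a gate. [folklore] -/
theorem clopCons {o : α → ClOp ℕ} {l : α → List (ClOp ℕ)} (ho : CodeFP eα clopE o) (hl : CodeFP eα (rawE clopE) l) :
    CodeFP eα (rawE clopE) (fun a => o a :: l a) := ((rawCons clopE).comp (ho.pair hl) :)

/-- Concatenating programs. [folklore] -/
theorem clopAppend {l l' : α → List (ClOp ℕ)} (hl : CodeFP eα (rawE clopE) l) (hl' : CodeFP eα (rawE clopE) l') :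
    CodeFP eα (rawE clopE) (fun a => l a ++ l' a) := ((rawAppend clopE).comp (hl.pair hl') :)

end ClopCodes

/-! ### Closed forms of the instruction templates -/

/-- One adder stage on `ℕ`-indexed wires given by the four wire maps. [cite: VedralBarencoEkert1996, §3.1] -/
def stageA (fa fb fs fc : ℕ → ℕ) (i : ℕ) : List (ClOp ℕ) :=
  [ClOp.toffoli (fa i) (fb i) (fc (i + 1)), ClOp.toffoli (fa i) (fc i) (fc (i + 1)), ClOp.toffoli (fb i) (fc i) (fc (i + 1)),
    ClOp.cnot (fa i) (fs i), ClOp.cnot (fb i) (fs i), ClOp.cnot (fc i) (fs i)]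

section Templates

variable {m : ℕ} (f : AddW m → ℕ) (fa fb fs fc : ℕ → ℕ) (ha : ∀ j : Fin m, f (AddW.a j) = fa j) (hb : ∀ j : Fin m, f (AddW.b j) = fb j)
  (hs : ∀ j : Fin m, f (AddW.s j) = fs j) (hc : ∀ j : Fin (m + 1), f (AddW.c j) = fc j)
include ha hb hs hc

/-- The re-indexed adder prefix is a concatenation of abstract stages. [folklore] -/
theorem map_addPrefix : ∀ i : ℕ, i ≤ m → (addPrefix i : List (ClOp (AddW m))).map (ClOp.map f) = (List.range i).flatMap (stageA fa fb fs fc)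
  | 0, _ => rfl
  | i + 1, hi => by
    rw [addPrefix, List.map_append, map_addPrefix i (by omega), dif_pos (by omega), List.range_succ, List.flatMap_append, List.flatMap_singleton]
    congr 1
    simp [addStage, stageA, ClOp.map, ha, hb, hs, hc]

/-- **The re-indexed adder.** [folklore] -/
theorem map_addOps : (addOps m).map (ClOp.map f) = (List.range m).flatMap (stageA fa fb fs fc) := map_addPrefix f fa fb fs fc ha hb hs hc m le_rfl

omit ha hs hc in
/-- The re-indexed `NOT` layer on the `b`-wires. [folklore] -/
theorem map_notOps_b : (notOps AddW.b : List (ClOp (AddW m))).map (ClOp.map f) = (List.range m).map fun j => ClOp.not (fb j) := by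
  rw [notOps, List.map_map, ← List.map_coe_finRange_eq_range, List.map_map]
  exact List.map_congr_left fun j _ => by simp [ClOp.map, hb]

/-- **The re-indexed comparator.** [folklore] -/
theorem map_ltOps : (ltOps m).map (ClOp.map f) =
    ((List.range m).map fun j => ClOp.not (fb j)) ++ (List.range m).flatMap (stageA fa fb fs fc) ++ (List.range m).map fun j => ClOp.not (fb j) := by
  rw [ltOps, List.map_append, List.map_append, map_notOps_b f fb hb, map_addOps f fa fb fs fc ha hb hs hc]

end Templates

variable {Wd : ℕ} (L : Layout)

/-- The abstract `add` row. [folklore] -/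
def addRowA (Wd : ℕ) (t d a b sh : ℕ) : List (ClOp ℕ) :=
  (List.range Wd).flatMap (stageA (fun j => L.regW (Wd := Wd) a j) (fun j => if sh ≤ j then L.regW (Wd := Wd) b (j - sh) else L.zerW (Wd := Wd) t j)
    (fun j => L.regW (Wd := Wd) d j) (fun j => L.carW (Wd := Wd) t j))

/-- The abstract `lt` row. [folklore] -/
def ltRowA (Wd : ℕ) (t f a b : ℕ) : List (ClOp ℕ) :=
  ((List.range Wd).map fun j => ClOp.not (L.regW (Wd := Wd) a j)) ++
    (List.range Wd).flatMap (stageA (fun j => L.regW (Wd := Wd) b j) (fun j => L.regW (Wd := Wd) a j) (fun j => L.sumW (Wd := Wd) t j) (fun j => L.carW (Wd := Wd) t j)) ++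
    ((List.range Wd).map fun j => ClOp.not (L.regW (Wd := Wd) a j)) ++ [ClOp.cnot (L.carW (Wd := Wd) t Wd) (L.flagW f)]

/-- The compiled `add` instruction in closed form. [folklore] -/
theorem compileInstr_add (t d a b sh : ℕ) : compileInstr L (Wd := Wd) t (.add d a b sh) = addRowA L Wd t d a b sh := by
  rw [compileInstr, addRowA]
  exact map_addOps (L.addEmb (Wd := Wd) t d a b sh) (fun j => L.regW (Wd := Wd) a j) (fun j => if sh ≤ j then L.regW (Wd := Wd) b (j - sh) else L.zerW (Wd := Wd) t j)
    (fun j => L.regW (Wd := Wd) d j) (fun j => L.carW (Wd := Wd) t j) (fun _ => rfl) (fun _ => rfl) (fun _ => rfl) (fun _ => rfl)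

/-- The compiled `lt` instruction in closed form. [folklore] -/
theorem compileInstr_lt (t f a b : ℕ) : compileInstr L (Wd := Wd) t (.lt f a b) = ltRowA L Wd t f a b := by
  rw [compileInstr, ltRowA,
    map_ltOps (L.ltEmb (Wd := Wd) t a b) (fun j => L.regW (Wd := Wd) b j) (fun j => L.regW (Wd := Wd) a j) (fun j => L.sumW (Wd := Wd) t j) (fun j => L.carW (Wd := Wd) t j)
      (fun _ => rfl) (fun _ => rfl) (fun _ => rfl) (fun _ => rfl)]

/-- The compiler on an instruction tuple (mirroring `compileInstr` case by case). [folklore] -/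
def compileInstrT (Wd : ℕ) (t : ℕ) (u : ℕ × ℕ × ℕ × ℕ × ℕ × ℕ) : List (ClOp ℕ) :=
  if u.1 = 0 then (List.range u.2.2.2.2.2).map fun j => ClOp.cnot (L.iw (u.2.2.1 + j)) (L.regW (Wd := Wd) u.2.1 j)
  else if u.1 = 1 then (if u.2.2.1 < Wd then [ClOp.not (L.regW (Wd := Wd) u.2.1 u.2.2.1)] else [])
  else if u.1 = 2 then addRowA L Wd t u.2.1 u.2.2.1 u.2.2.2.1 u.2.2.2.2.1
  else if u.1 = 3 then (List.range Wd).map fun j => ClOp.toffoli (L.regW (Wd := Wd) u.2.2.1 u.2.2.2.1) (L.regW (Wd := Wd) u.2.2.2.2.1 j) (L.regW (Wd := Wd) u.2.1 j)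
  else if u.1 = 4 then ltRowA L Wd t u.2.1 u.2.2.1 u.2.2.2.1
  else if u.1 = 5 then [ClOp.cnot (L.flagW u.2.2.1) (L.flagW u.2.1), ClOp.not (L.flagW u.2.1)]
  else if u.1 = 6 then [ClOp.toffoli (L.flagW u.2.2.1) (L.flagW u.2.2.2.1) (L.flagW u.2.1)]
  else [ClOp.not (L.flagW u.2.2.1), ClOp.not (L.flagW u.2.2.2.1), ClOp.toffoli (L.flagW u.2.2.1) (L.flagW u.2.2.2.1) (L.flagW u.2.1),
    ClOp.not (L.flagW u.2.1), ClOp.not (L.flagW u.2.2.1), ClOp.not (L.flagW u.2.2.2.1)]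

/-- **The compiler on an instruction is the tuple compiler on its tuple.** [folklore] -/
theorem compileInstr_eq_T (t : ℕ) (ins : Instr) : compileInstr L (Wd := Wd) t ins = compileInstrT L Wd t (instrTuple ins) := by
  cases ins with
  | copyIn d off len => rfl
  | setBit d i => rfl
  | add d a b sh => exact compileInstr_add L t d a b sh
  | andBit d x i y => rfl
  | lt f a b => exact compileInstr_lt L t f a b
  | fnot f g => rfl
  | fand f g h => rfl
  | forr f g h => rfl

/-- **Compilation of a program is `flatten ∘ mapIdx`.** [folklore] -/
theorem compileFrom_eq : ∀ (t₀ : ℕ) (p : List Instr), compileFrom L (Wd := Wd) t₀ p = (p.mapIdx fun i ins => compileInstr L (Wd := Wd) (t₀ + i) ins).flatten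
  | _, [] => rfl
  | t₀, ins :: p => by
    rw [compileFrom, compileFrom_eq (t₀ + 1) p, List.mapIdx_cons, List.flatten_cons, Nat.add_zero]
    congr 3
    funext i ins
    rw [show t₀ + 1 + i = t₀ + (i + 1) by omega]

/-! ### Branching on a decidable proposition -/

/-- `if P a then … else …` on codes, from the computed bit `decide (P a)`. [folklore] -/
theorem iteProp {α β : Type} {eα : α → List Bool} {eβ : β → List Bool} {P : α → Prop} [DecidablePred P] {g h : α → β}
    (hp : CodeFP eα bitE (fun a => decide (P a))) (hg : CodeFP eα eβ g) (hh : CodeFP eα eβ h) :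
    CodeFP eα eβ (fun a => if P a then g a else h a) :=
  (hp.ite hg hh).congr fun a => by by_cases hP : P a <;> simp [hP]

/-! ### The layout compiler on codes -/

/-- Instruction tuples. [folklore] -/
abbrev TU : Type := ℕ × ℕ × ℕ × ℕ × ℕ × ℕ

section CompileFP

variable {σ : Type} {eσ : σ → List Bool} {L : σ → List ℕ → Layout} {W : σ → ℕ}

/-- **Layouts computed on codes**: for a family of layouts `L s ins` (context `s`, further input wires
`ins`) of width `W s`, the input-wire map and the three bases are computed on codes, and the width in
unary. [folklore] -/
structure LayoutFP (eσ : σ → List Bool) (L : σ → List ℕ → Layout) (W : σ → ℕ) : Prop where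
  /-- the input wires -/
  iw : CodeFP (pairE (pairE eσ (rawE natE)) natE) natE (fun t => (L t.1.1 t.1.2).iw t.2)
  /-- the register base -/
  rb : CodeFP (pairE eσ (rawE natE)) natE (fun t => (L t.1 t.2).rb)
  /-- the flag base -/
  fb : CodeFP (pairE eσ (rawE natE)) natE (fun t => (L t.1 t.2).fb)
  /-- the scratch base -/
  sb : CodeFP (pairE eσ (rawE natE)) natE (fun t => (L t.1 t.2).sb)
  /-- the width, in unary -/
  wd : CodeFP eσ unE W

variable (H : LayoutFP eσ L W)
include H

/-- The code of the contexts `((s, ins), t, u)` of the instruction compiler. [folklore] -/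
abbrev γE (eσ : σ → List Bool) : (σ × List ℕ) × ℕ × TU → List Bool := pairE (pairE eσ (rawE natE)) (pairE natE tupE)

omit H in
/-- Accessors of the instruction context. [folklore] -/
theorem γ_acc :
    CodeFP (γE eσ) natE (fun g => g.2.1) ∧ CodeFP (γE eσ) natE (fun g => g.2.2.1) ∧ CodeFP (γE eσ) natE (fun g => g.2.2.2.1) ∧
    CodeFP (γE eσ) natE (fun g => g.2.2.2.2.1) ∧ CodeFP (γE eσ) natE (fun g => g.2.2.2.2.2.1) ∧ CodeFP (γE eσ) natE (fun g => g.2.2.2.2.2.2.1) ∧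
    CodeFP (γE eσ) unE (fun g => g.2.2.2.2.2.2.2) :=
  ⟨(snd _ _).fst', (snd _ _).snd'.fst', (snd _ _).snd'.snd'.fst', (snd _ _).snd'.snd'.snd'.fst', (snd _ _).snd'.snd'.snd'.snd'.fst',
    (snd _ _).snd'.snd'.snd'.snd'.snd'.fst', (snd _ _).snd'.snd'.snd'.snd'.snd'.snd'⟩

/-- The bases and the width in the instruction context. [folklore] -/
theorem γ_base :
    CodeFP (γE eσ) natE (fun g => (L g.1.1 g.1.2).rb) ∧ CodeFP (γE eσ) natE (fun g => (L g.1.1 g.1.2).fb) ∧ CodeFP (γE eσ) natE (fun g => (L g.1.1 g.1.2).sb) ∧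
    CodeFP (γE eσ) natE (fun g => W g.1.1) ∧ CodeFP (γE eσ) unE (fun g => W g.1.1) :=
  ⟨H.rb.comp (fst _ _), H.fb.comp (fst _ _), H.sb.comp (fst _ _), (natOfUn.comp (H.wd.comp (fst _ _).fst')).congr fun _ => rfl, H.wd.comp (fst _ _).fst'⟩

omit H in
/-- Register wires `rb + ρ·Wd + j` on codes. [folklore] -/
theorem regW_fp {α : Type} {eα : α → List Bool} {RB WD ρ j : α → ℕ} (hrb : CodeFP eα natE RB) (hW : CodeFP eα natE WD) (hρ : CodeFP eα natE ρ) (hj : CodeFP eα natE j) :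
    CodeFP eα natE (fun a => RB a + ρ a * WD a + j a) := (natAdd.comp ((natAdd.comp (hrb.pair (natMul.comp (hρ.pair hW)))).pair hj) :)

omit H in
/-- Scratch wires `sb + t·(3Wd+1) + o + j` on codes. [folklore] -/
theorem scrW_fp {α : Type} {eα : α → List Bool} {SB WD t o j : α → ℕ} (hsb : CodeFP eα natE SB) (hW : CodeFP eα natE WD) (ht : CodeFP eα natE t) (ho : CodeFP eα natE o) (hj : CodeFP eα natE j) :
    CodeFP eα natE (fun a => SB a + t a * scrSize (WD a) + o a + j a) := by
  have hscr : CodeFP eα natE (fun a => scrSize (WD a)) := ((natAdd.comp ((natMul.comp ((const eα 3).pair hW)).pair (const eα 1))).congr fun _ => rfl :)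
  exact (natAdd.comp ((natAdd.comp ((natAdd.comp (hsb.pair (natMul.comp (ht.pair hscr)))).pair ho)).pair hj) :)

/-- **`copyIn` rows on codes.** [folklore] -/
theorem copyIn_fp : CodeFP (γE eσ) (rawE clopE) (fun g => (List.range g.2.2.2.2.2.2.2).map fun j =>
    ClOp.cnot ((L g.1.1 g.1.2).iw (g.2.2.2.2.1 + j)) ((L g.1.1 g.1.2).regW (Wd := W g.1.1) g.2.2.2.1 j)) := by
  obtain ⟨-, -, g1, g2, -, -, glen⟩ := γ_acc (eσ := eσ)
  obtain ⟨grb, -, -, gWn, -⟩ := γ_base H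
  have hiw : CodeFP (pairE (γE eσ) natE) natE (fun d => (L d.1.1.1 d.1.1.2).iw (d.1.2.2.2.2.1 + d.2)) :=
    (H.iw.comp (((fst _ _).fst').pair (natAdd.comp ((g2.comp (fst _ _)).pair (snd _ _)))) :)
  have hreg : CodeFP (pairE (γE eσ) natE) natE (fun d => (L d.1.1.1 d.1.1.2).rb + d.1.2.2.2.1 * (W d.1.1.1) + d.2) :=
    regW_fp (grb.comp (fst _ _)) (gWn.comp (fst _ _)) (g1.comp (fst _ _)) (snd _ _)
  have hitem : CodeFP (pairE (γE eσ) natE) clopE (fun d => ClOp.cnot ((L d.1.1.1 d.1.1.2).iw (d.1.2.2.2.2.1 + d.2)) ((L d.1.1.1 d.1.1.2).regW (Wd := (W d.1.1.1)) d.1.2.2.2.1 d.2)) :=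
    clop_cnot hiw hreg
  exact ((map hitem).comp ((CodeFP.id _).pair (urange.comp glen))).congr fun _ => rfl

/-- **`setBit` on codes.** [folklore] -/
theorem setBit_fp : CodeFP (γE eσ) (rawE clopE) (fun g => if g.2.2.2.2.1 < (W g.1.1) then [ClOp.not ((L g.1.1 g.1.2).regW (Wd := (W g.1.1)) g.2.2.2.1 g.2.2.2.2.1)] else []) := by
  obtain ⟨-, -, g1, g2, -, -, -⟩ := γ_acc (eσ := eσ)
  obtain ⟨grb, -, -, gWn, -⟩ := γ_base H
  exact iteProp (natLt.comp (g2.pair gWn)) (clopList1 (clop_not (regW_fp grb gWn g1 g2))) (const _ [])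

/-- An adder row on codes, for wire maps computed on the codes of `(context, bit index)`. [folklore] -/
theorem stages_fp {fa fb fs fc fc1 : (σ × List ℕ) × ℕ × TU → ℕ → ℕ}
    (ha : CodeFP (pairE (γE eσ) natE) natE (fun d => fa d.1 d.2)) (hb : CodeFP (pairE (γE eσ) natE) natE (fun d => fb d.1 d.2))
    (hs : CodeFP (pairE (γE eσ) natE) natE (fun d => fs d.1 d.2)) (hc : CodeFP (pairE (γE eσ) natE) natE (fun d => fc d.1 d.2))
    (hc1 : CodeFP (pairE (γE eσ) natE) natE (fun d => fc1 d.1 d.2)) (hcc : ∀ g j, fc1 g j = fc g (j + 1)) :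
    CodeFP (γE eσ) (rawE clopE) (fun g => (List.range (W g.1.1)).flatMap (stageA (fa g) (fb g) (fs g) (fc g))) := by
  obtain ⟨-, -, -, -, gWu⟩ := γ_base H
  have hstage : CodeFP (pairE (γE eσ) natE) (rawE clopE) (fun d => [ClOp.toffoli (fa d.1 d.2) (fb d.1 d.2) (fc1 d.1 d.2),
      ClOp.toffoli (fa d.1 d.2) (fc d.1 d.2) (fc1 d.1 d.2), ClOp.toffoli (fb d.1 d.2) (fc d.1 d.2) (fc1 d.1 d.2),
      ClOp.cnot (fa d.1 d.2) (fs d.1 d.2), ClOp.cnot (fb d.1 d.2) (fs d.1 d.2), ClOp.cnot (fc d.1 d.2) (fs d.1 d.2)]) :=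
    clopCons (clop_toffoli ha hb hc1) (clopCons (clop_toffoli ha hc hc1) (clopCons (clop_toffoli hb hc hc1)
      (clopCons (clop_cnot ha hs) (clopCons (clop_cnot hb hs) (clopList1 (clop_cnot hc hs))))))
  refine (((flatten clopE).comp ((map hstage).comp ((CodeFP.id _).pair (urange.comp gWu)))).congr fun g => ?_)
  rw [List.flatMap]
  congr 1
  exact List.map_congr_left fun j _ => by simp only [stageA, hcc, id]

/-- **`add` rows on codes.** [folklore] -/
theorem addRow_fp : CodeFP (γE eσ) (rawE clopE) (fun g => addRowA (L g.1.1 g.1.2) (W g.1.1) g.2.1 g.2.2.2.1 g.2.2.2.2.1 g.2.2.2.2.2.1 g.2.2.2.2.2.2.1) := by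
  obtain ⟨gt, -, g1, g2, g3, g4, -⟩ := γ_acc (eσ := eσ)
  obtain ⟨grb, -, gsb, gWn, -⟩ := γ_base H
  have hj : CodeFP (pairE (γE eσ) natE) natE (fun d => d.2) := snd _ _
  have ha : CodeFP (pairE (γE eσ) natE) natE (fun d => (L d.1.1.1 d.1.1.2).regW (Wd := (W d.1.1.1)) d.1.2.2.2.2.1 d.2) :=
    regW_fp (grb.comp (fst _ _)) (gWn.comp (fst _ _)) (g2.comp (fst _ _)) hj
  have hbreg : CodeFP (pairE (γE eσ) natE) natE (fun d => (L d.1.1.1 d.1.1.2).regW (Wd := (W d.1.1.1)) d.1.2.2.2.2.2.1 (d.2 - d.1.2.2.2.2.2.2.1)) :=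
    regW_fp (grb.comp (fst _ _)) (gWn.comp (fst _ _)) (g3.comp (fst _ _)) (natSub.comp (hj.pair (g4.comp (fst _ _))))
  have hzer : CodeFP (pairE (γE eσ) natE) natE (fun d => (L d.1.1.1 d.1.1.2).zerW (Wd := (W d.1.1.1)) d.1.2.1 d.2) :=
    scrW_fp (gsb.comp (fst _ _)) (gWn.comp (fst _ _)) (gt.comp (fst _ _)) (natAdd.comp ((gWn.comp (fst _ _)).pair (const _ 1))) hj
  have hb : CodeFP (pairE (γE eσ) natE) natE (fun d => if d.1.2.2.2.2.2.2.1 ≤ d.2 then (L d.1.1.1 d.1.1.2).regW (Wd := (W d.1.1.1)) d.1.2.2.2.2.2.1 (d.2 - d.1.2.2.2.2.2.2.1) else (L d.1.1.1 d.1.1.2).zerW (Wd := (W d.1.1.1)) d.1.2.1 d.2) :=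
    iteProp (natLe.comp ((g4.comp (fst _ _)).pair hj)) hbreg hzer
  have hs : CodeFP (pairE (γE eσ) natE) natE (fun d => (L d.1.1.1 d.1.1.2).regW (Wd := (W d.1.1.1)) d.1.2.2.2.1 d.2) :=
    regW_fp (grb.comp (fst _ _)) (gWn.comp (fst _ _)) (g1.comp (fst _ _)) hj
  have hc : CodeFP (pairE (γE eσ) natE) natE (fun d => (L d.1.1.1 d.1.1.2).carW (Wd := (W d.1.1.1)) d.1.2.1 d.2) :=
    scrW_fp (gsb.comp (fst _ _)) (gWn.comp (fst _ _)) (gt.comp (fst _ _)) (const _ 0) hj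
  have hc1 : CodeFP (pairE (γE eσ) natE) natE (fun d => (L d.1.1.1 d.1.1.2).carW (Wd := (W d.1.1.1)) d.1.2.1 (d.2 + 1)) :=
    scrW_fp (gsb.comp (fst _ _)) (gWn.comp (fst _ _)) (gt.comp (fst _ _)) (const _ 0) (natAdd.comp (hj.pair (const _ 1)))
  exact stages_fp H (fa := fun g j => (L g.1.1 g.1.2).regW (Wd := (W g.1.1)) g.2.2.2.2.1 j)
    (fb := fun g j => if g.2.2.2.2.2.2.1 ≤ j then (L g.1.1 g.1.2).regW (Wd := (W g.1.1)) g.2.2.2.2.2.1 (j - g.2.2.2.2.2.2.1) else (L g.1.1 g.1.2).zerW (Wd := (W g.1.1)) g.2.1 j)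
    (fs := fun g j => (L g.1.1 g.1.2).regW (Wd := (W g.1.1)) g.2.2.2.1 j) (fc := fun g j => (L g.1.1 g.1.2).carW (Wd := (W g.1.1)) g.2.1 j)
    (fc1 := fun g j => (L g.1.1 g.1.2).carW (Wd := (W g.1.1)) g.2.1 (j + 1)) ha hb hs hc hc1 (fun _ _ => rfl)

/-- **`andBit` rows on codes.** [folklore] -/
theorem andBit_fp : CodeFP (γE eσ) (rawE clopE) (fun g => (List.range (W g.1.1)).map fun j =>
    ClOp.toffoli ((L g.1.1 g.1.2).regW (Wd := (W g.1.1)) g.2.2.2.2.1 g.2.2.2.2.2.1) ((L g.1.1 g.1.2).regW (Wd := (W g.1.1)) g.2.2.2.2.2.2.1 j) ((L g.1.1 g.1.2).regW (Wd := (W g.1.1)) g.2.2.2.1 j)) := by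
  obtain ⟨-, -, g1, g2, g3, g4, -⟩ := γ_acc (eσ := eσ)
  obtain ⟨grb, -, -, gWn, gWu⟩ := γ_base H
  have hj : CodeFP (pairE (γE eσ) natE) natE (fun d => d.2) := snd _ _
  have h1 : CodeFP (pairE (γE eσ) natE) natE (fun d => (L d.1.1.1 d.1.1.2).regW (Wd := (W d.1.1.1)) d.1.2.2.2.2.1 d.1.2.2.2.2.2.1) :=
    regW_fp (grb.comp (fst _ _)) (gWn.comp (fst _ _)) (g2.comp (fst _ _)) (g3.comp (fst _ _))
  have h2 : CodeFP (pairE (γE eσ) natE) natE (fun d => (L d.1.1.1 d.1.1.2).regW (Wd := (W d.1.1.1)) d.1.2.2.2.2.2.2.1 d.2) :=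
    regW_fp (grb.comp (fst _ _)) (gWn.comp (fst _ _)) (g4.comp (fst _ _)) hj
  have h3 : CodeFP (pairE (γE eσ) natE) natE (fun d => (L d.1.1.1 d.1.1.2).regW (Wd := (W d.1.1.1)) d.1.2.2.2.1 d.2) :=
    regW_fp (grb.comp (fst _ _)) (gWn.comp (fst _ _)) (g1.comp (fst _ _)) hj
  exact ((map (clop_toffoli h1 h2 h3)).comp ((CodeFP.id _).pair (urange.comp gWu))).congr fun _ => rfl

/-- **`lt` rows on codes.** [folklore] -/
theorem ltRow_fp : CodeFP (γE eσ) (rawE clopE) (fun g => ltRowA (L g.1.1 g.1.2) (W g.1.1) g.2.1 g.2.2.2.1 g.2.2.2.2.1 g.2.2.2.2.2.1) := by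
  obtain ⟨gt, -, g1, g2, g3, -, -⟩ := γ_acc (eσ := eσ)
  obtain ⟨grb, gfb, gsb, gWn, gWu⟩ := γ_base H
  have hj : CodeFP (pairE (γE eσ) natE) natE (fun d => d.2) := snd _ _
  have hra : CodeFP (pairE (γE eσ) natE) natE (fun d => (L d.1.1.1 d.1.1.2).regW (Wd := (W d.1.1.1)) d.1.2.2.2.2.1 d.2) :=
    regW_fp (grb.comp (fst _ _)) (gWn.comp (fst _ _)) (g2.comp (fst _ _)) hj
  have hrb : CodeFP (pairE (γE eσ) natE) natE (fun d => (L d.1.1.1 d.1.1.2).regW (Wd := (W d.1.1.1)) d.1.2.2.2.2.2.1 d.2) :=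
    regW_fp (grb.comp (fst _ _)) (gWn.comp (fst _ _)) (g3.comp (fst _ _)) hj
  have hsum : CodeFP (pairE (γE eσ) natE) natE (fun d => (L d.1.1.1 d.1.1.2).sumW (Wd := (W d.1.1.1)) d.1.2.1 d.2) :=
    scrW_fp (gsb.comp (fst _ _)) (gWn.comp (fst _ _)) (gt.comp (fst _ _)) (natAdd.comp ((natMul.comp ((const _ 2).pair (gWn.comp (fst _ _)))).pair (const _ 1))) hj
  have hc : CodeFP (pairE (γE eσ) natE) natE (fun d => (L d.1.1.1 d.1.1.2).carW (Wd := (W d.1.1.1)) d.1.2.1 d.2) :=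
    scrW_fp (gsb.comp (fst _ _)) (gWn.comp (fst _ _)) (gt.comp (fst _ _)) (const _ 0) hj
  have hc1 : CodeFP (pairE (γE eσ) natE) natE (fun d => (L d.1.1.1 d.1.1.2).carW (Wd := (W d.1.1.1)) d.1.2.1 (d.2 + 1)) :=
    scrW_fp (gsb.comp (fst _ _)) (gWn.comp (fst _ _)) (gt.comp (fst _ _)) (const _ 0) (natAdd.comp (hj.pair (const _ 1)))
  have hnots : CodeFP (γE eσ) (rawE clopE) (fun g => (List.range (W g.1.1)).map fun j => ClOp.not ((L g.1.1 g.1.2).regW (Wd := (W g.1.1)) g.2.2.2.2.1 j)) :=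
    ((map (clop_not hra)).comp ((CodeFP.id _).pair (urange.comp gWu))).congr fun _ => rfl
  have hstages := stages_fp H (fa := fun g j => (L g.1.1 g.1.2).regW (Wd := (W g.1.1)) g.2.2.2.2.2.1 j) (fb := fun g j => (L g.1.1 g.1.2).regW (Wd := (W g.1.1)) g.2.2.2.2.1 j)
    (fs := fun g j => (L g.1.1 g.1.2).sumW (Wd := (W g.1.1)) g.2.1 j) (fc := fun g j => (L g.1.1 g.1.2).carW (Wd := (W g.1.1)) g.2.1 j)
    (fc1 := fun g j => (L g.1.1 g.1.2).carW (Wd := (W g.1.1)) g.2.1 (j + 1)) hrb hra hsum hc hc1 (fun _ _ => rfl)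
  have hcW : CodeFP (γE eσ) natE (fun g => (L g.1.1 g.1.2).carW (Wd := (W g.1.1)) g.2.1 (W g.1.1)) := scrW_fp gsb gWn gt (const _ 0) gWn
  have hfl : CodeFP (γE eσ) natE (fun g => (L g.1.1 g.1.2).flagW g.2.2.2.1) := ((natAdd.comp (gfb.pair g1)).congr fun _ => rfl :)
  have hlast : CodeFP (γE eσ) (rawE clopE) (fun g => [ClOp.cnot ((L g.1.1 g.1.2).carW (Wd := (W g.1.1)) g.2.1 (W g.1.1)) ((L g.1.1 g.1.2).flagW g.2.2.2.1)]) := clopList1 (clop_cnot hcW hfl)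
  exact (clopAppend (clopAppend (clopAppend hnots hstages) hnots) hlast).congr fun _ => rfl

/-- **The flag instructions on codes.** [folklore] -/
theorem flags_fp :
    CodeFP (γE eσ) (rawE clopE) (fun g => [ClOp.cnot ((L g.1.1 g.1.2).flagW g.2.2.2.2.1) ((L g.1.1 g.1.2).flagW g.2.2.2.1), ClOp.not ((L g.1.1 g.1.2).flagW g.2.2.2.1)]) ∧
    CodeFP (γE eσ) (rawE clopE) (fun g => [ClOp.toffoli ((L g.1.1 g.1.2).flagW g.2.2.2.2.1) ((L g.1.1 g.1.2).flagW g.2.2.2.2.2.1) ((L g.1.1 g.1.2).flagW g.2.2.2.1)]) ∧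
    CodeFP (γE eσ) (rawE clopE) (fun g => [ClOp.not ((L g.1.1 g.1.2).flagW g.2.2.2.2.1), ClOp.not ((L g.1.1 g.1.2).flagW g.2.2.2.2.2.1),
      ClOp.toffoli ((L g.1.1 g.1.2).flagW g.2.2.2.2.1) ((L g.1.1 g.1.2).flagW g.2.2.2.2.2.1) ((L g.1.1 g.1.2).flagW g.2.2.2.1),
      ClOp.not ((L g.1.1 g.1.2).flagW g.2.2.2.1), ClOp.not ((L g.1.1 g.1.2).flagW g.2.2.2.2.1), ClOp.not ((L g.1.1 g.1.2).flagW g.2.2.2.2.2.1)]) := by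
  obtain ⟨-, -, g1, g2, g3, -, -⟩ := γ_acc (eσ := eσ)
  obtain ⟨-, gfb, -, -, -⟩ := γ_base H
  have f1 : CodeFP (γE eσ) natE (fun g => (L g.1.1 g.1.2).flagW g.2.2.2.1) := ((natAdd.comp (gfb.pair g1)).congr fun _ => rfl :)
  have f2 : CodeFP (γE eσ) natE (fun g => (L g.1.1 g.1.2).flagW g.2.2.2.2.1) := ((natAdd.comp (gfb.pair g2)).congr fun _ => rfl :)
  have f3 : CodeFP (γE eσ) natE (fun g => (L g.1.1 g.1.2).flagW g.2.2.2.2.2.1) := ((natAdd.comp (gfb.pair g3)).congr fun _ => rfl :)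
  exact ⟨clopCons (clop_cnot f2 f1) (clopList1 (clop_not f1)), clopList1 (clop_toffoli f2 f3 f1),
    clopCons (clop_not f2) (clopCons (clop_not f3) (clopCons (clop_toffoli f2 f3 f1) (clopCons (clop_not f1) (clopCons (clop_not f2) (clopList1 (clop_not f3))))))⟩

/-- **The instruction compiler on tuples, on codes.** [folklore] -/
theorem compileInstrT_fp : CodeFP (γE eσ) (rawE clopE) (fun g => compileInstrT (L g.1.1 g.1.2) (W g.1.1) g.2.1 g.2.2) := by
  obtain ⟨h5, h6, h7⟩ := flags_fp H
  have htag : ∀ c : ℕ, CodeFP (γE eσ) bitE (fun g => decide (g.2.2.1 = c)) := fun c => natEq.comp ((snd _ _).snd'.fst'.pair (const _ c))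
  exact iteProp (htag 0) (copyIn_fp H) (iteProp (htag 1) (setBit_fp H) (iteProp (htag 2) (addRow_fp H) (iteProp (htag 3) (andBit_fp H)
    (iteProp (htag 4) (ltRow_fp H) (iteProp (htag 5) h5 (iteProp (htag 6) h6 h7))))))

/-- **The instruction compiler on codes.** [folklore] -/
theorem compileInstr_fp : CodeFP (pairE (pairE eσ (rawE natE)) (pairE natE instrE)) (rawE clopE)
    (fun g => compileInstr (L g.1.1 g.1.2) (Wd := W g.1.1) g.2.1 g.2.2) := by
  have hre : CodeFP (pairE (pairE eσ (rawE natE)) (pairE natE instrE)) (γE eσ) (fun g => (g.1, g.2.1, instrTuple g.2.2)) := transparent fun _ => rfl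
  exact ((compileInstrT_fp H).comp hre).congr fun g => (compileInstr_eq_T _ _ _).symm

/-- **The layout compiler in polynomial time**: `(s, ins, prog) ↦ SLP.compile (L s ins) prog`.
[cite: AroraBarak2009, §1.3 and §6.2] -/
theorem compile_codeFP : CodeFP (pairE eσ (pairE (rawE natE) (rawE instrE))) (rawE clopE) (fun t => SLP.compile (L t.1 t.2.1) (Wd := W t.1) t.2.2) := by
  have h1 : CodeFP (pairE (pairE eσ (rawE natE)) (rawE instrE)) (rawE (rawE clopE))
      (fun q => q.2.mapIdx fun i ins => compileInstr (L q.1.1 q.1.2) (Wd := W q.1.1) i ins) := mapIdx (compileInstr_fp H)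
  have hre : CodeFP (pairE eσ (pairE (rawE natE) (rawE instrE))) (pairE (pairE eσ (rawE natE)) (rawE instrE)) (fun t => ((t.1, t.2.1), t.2.2)) :=
    ((fst _ _).pair (snd _ _).fst').pair (snd _ _).snd'
  exact (((flatten clopE).comp h1).comp hre).congr fun t => by
    show _ = compileFrom _ 0 _
    rw [compileFrom_eq]; simp only [Nat.zero_add]

end CompileFP

end AJLCore

end Literature.Computability.QuantumComplexity

end
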